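import Literature.Combinatorics.SimpleGraph.TreeSubtreeLayerCount   -- ★ `TreeLayers.ncard_sphere_eq_of_biregular` (spheres of a bi-regular tree), retraction-data conventions (F0P3a-p08 (g17))
import HarnessLib

/-!
# Layers around a BALL are spheres: `dist(v, B(r, n)) = dist(r, v) − n`, the ball is a subtree, and the sphere counts `C_k = #S_{n+k}(r)` (Serre, *Trees* I.2.3, II.1.1)

Topic `Combinatorics/SimpleGraph`; namespace `Literature.Combinatorics.SimpleGraph.BallLayers`.  THEOREMS ONLY (no definition, no instance, no notation, no named fact, no
`sorry`); Mathlib + ★ `TreeSubtreeLayerCount`; arbitrary vertex type.  Cell `pub/hodgecm-mathlib`, F0∕P3a, crux H413 = `stmt-HodgeConjecture-24833`, line «N6nsGerm», residue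
`stub_N6nsS3id`, road «S3-tree» (CENSUS «S3» v3 = deal sheet, architect A-p16 (g28): «T2-core ★ p845190 … `Fix γ`, shells, `C_k(γ)` instantiate ★ p845190»; executor's LAW SHEET L5
«tree lemma ⇒ Hecke rows = sphere counts `C_k`»; SPEC S3-T0 §1 «deep `γ` fixes exactly a ball around the fixed point of its torus: radius `≈ n`»).  When the fixed subtree IS a ball
`B(r, n)` (the elliptic torus families of T0 with coinciding depth coordinates), the layers of ★ `exists_retraction` around it are the SPHERES `S_{n+k}(r)`, so `C_k(γ) = #S_{n+k}(r)` is
the ★ bi-regular closed form.  Written by F0P3a-p08 (g17) («tree organs» hand of the deal sheet) as a GENERIC organ — §1–§2 hold in ANY connected graph.  HONEST LABEL: HC_CM is proved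
only modulo the printed citations (the 2 remaining named inputs hLiu418, h413) until rung 0 closes; pure graph theory here.

* §1 (any connected graph) `dist_getVert_le` ∕ `dist_getVert_eq` (a vertex of a geodesic splits the distance), **`connected_induce_ball`** (a ball `{y | G.dist r y ≤ n}` induces a
  connected subgraph — geodesics from the centre stay inside), **`exists_mem_ball_dist_eq_sub`** (for `n ≤ dist(r, v)` some `y ∈ B(r, n)` has `dist(v, y) = dist(r, v) − n`),
  **`sub_le_dist_of_mem_ball`** (`dist(r, v) − n ≤ dist(v, y)` for every `y ∈ B(r, n)`).
* §2 **`height_ball_eq_dist_sub`** — for ANY height data `h` «attained and minimal over `B(r, n)`» (the first clause of ★ `exists_retraction` with `Y = B(r, n)`): `h v = G.dist r v − n`;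
  hence **`setOf_height_ball_eq_sphere`**: `{v | h v = k} = {v | G.dist r v = n + k}` for `k ≥ 1` — THE LAYERS AROUND A BALL ARE SPHERES.
* §3 (bi-regular tree) **`ncard_layer_ball_eq_of_biregular`** — `#{v | h v = k} = (q a + 1)·(q b)^{⌊(n+k)∕2⌋}·(q a)^{⌊(n+k−1)∕2⌋}` (`a = c r ≠ b`, `k ≥ 1`): with ★ p845190's sphere
  dictionary, the displaced-Hecke counts `C_k(γ) = #{v | d(v, γv) = 2k}` of an elliptic `γ` with `Fix γ = B(r, n)` in the `(q³+1, q+1)`-tree.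

## References
* [Serre1980Trees] J.-P. Serre, *Trees*, Springer (1980): I.2.3 (projection onto a subtree), II.1.1 (spheres of the tree of `SL₂`).
* [Diestel2010] R. Diestel, *Graph Theory*, 4th ed., §1.3 (distance, balls), Thm. 1.5.1.
-/

set_option autoImplicit false

open SimpleGraph

namespace Literature.Combinatorics.SimpleGraph.BallLayers

variable {V : Type*} {G : SimpleGraph V}

/-! ## §1 Balls in a connected graph -/

/-- **A vertex of a geodesic splits the distance**: if `W : r ⇝ v` has `W.length = dist(r, v)` then `dist(r, W_i) ≤ i` and `dist(W_i, v) ≤ dist(r, v) − i`, hence (triangle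
inequality) both are equalities when `i ≤ dist(r, v)`. [cite: Diestel2010, §1.3] -/
theorem dist_getVert_le {r v : V} {W : G.Walk r v} (hW : W.length = G.dist r v) (i : ℕ) :
    G.dist r (W.getVert i) ≤ i ∧ G.dist (W.getVert i) v ≤ G.dist r v - i := by
  constructor
  · calc G.dist r (W.getVert i) ≤ (W.take i).length := dist_le _
      _ ≤ i := by rw [Walk.take_length]; exact min_le_left _ _
  · calc G.dist (W.getVert i) v ≤ (W.drop i).length := dist_le _
      _ = G.dist r v - i := by rw [Walk.drop_length, hW]

/-- The equality case: for `i ≤ dist(r, v)`, `dist(r, W_i) = i` and `dist(W_i, v) = dist(r, v) − i`. [cite: Diestel2010, §1.3] -/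
theorem dist_getVert_eq (hc : G.Connected) {r v : V} {W : G.Walk r v} (hW : W.length = G.dist r v) {i : ℕ} (hi : i ≤ G.dist r v) :
    G.dist r (W.getVert i) = i ∧ G.dist (W.getVert i) v = G.dist r v - i := by
  obtain ⟨h1, h2⟩ := dist_getVert_le hW i
  have htri : G.dist r v ≤ G.dist r (W.getVert i) + G.dist (W.getVert i) v := hc.dist_triangle
  omega

/-- **A ball induces a connected subgraph** of a connected graph: the geodesic from the centre to a point of `B(r, n)` stays in `B(r, n)`. [cite: Diestel2010, §1.3] -/
theorem connected_induce_ball (hc : G.Connected) (r : V) (n : ℕ) : (G.induce {y | G.dist r y ≤ n}).Connected := by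
  refine induce_connected_of_patches r (by simp) fun {v} hv => ?_
  obtain ⟨W, hW⟩ := hc.exists_walk_length_eq_dist r v
  refine ⟨{w | w ∈ W.support}, fun w hw => ?_, W.start_mem_support, W.end_mem_support, (W.connected_induce_support).preconnected _ _⟩
  -- a support vertex `w = W_i` has `dist r w ≤ i ≤ length = dist r v ≤ n`
  rw [Set.mem_setOf_eq] at hw ⊢
  obtain ⟨i, hi, rfl⟩ : ∃ i, i ≤ W.length ∧ W.getVert i = w := by
    rw [Walk.mem_support_iff_exists_getVert] at hw
    obtain ⟨i, h1, h2⟩ := hw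
    exact ⟨i, h2, h1⟩
  have := (dist_getVert_le hW i).1
  rw [Set.mem_setOf_eq] at hv
  omega

/-- **For `n ≤ dist(r, v)` some point of the ball `B(r, n)` is at distance `dist(r, v) − n` from `v`** (the point at distance `n` on a geodesic). [cite: Diestel2010, §1.3] -/
theorem exists_mem_ball_dist_eq_sub (hc : G.Connected) (r : V) (n : ℕ) {v : V} (hn : n ≤ G.dist r v) :
    ∃ y, G.dist r y ≤ n ∧ G.dist v y = G.dist r v - n := by
  obtain ⟨W, hW⟩ := hc.exists_walk_length_eq_dist r v
  obtain ⟨h1, h2⟩ := dist_getVert_eq hc hW hn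
  exact ⟨W.getVert n, h1.le, by rw [dist_comm, h2]⟩

/-- **Every point of the ball is at distance `≥ dist(r, v) − n` from `v`** (triangle inequality). [cite: Diestel2010, §1.3] -/
theorem sub_le_dist_of_mem_ball (hc : G.Connected) (r : V) (n : ℕ) {v y : V} (hy : G.dist r y ≤ n) : G.dist r v - n ≤ G.dist v y := by
  have htri : G.dist r v ≤ G.dist r y + G.dist y v := hc.dist_triangle
  rw [dist_comm (u := y)] at htri
  omega

/-! ## §2 The layers around a ball are spheres -/

/-- **The height above the ball `B(r, n)` is `dist(r, ·) − n`**: any `h : V → ℕ` that is «attained and minimal over the ball» (the distance clause of ★ `TreeRetraction.exists_retraction`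
with `Y = {y | G.dist r y ≤ n}`) satisfies `h v = G.dist r v − n` (also inside the ball, where both sides vanish). [cite: Serre1980Trees, I.2.3] -/
theorem height_ball_eq_dist_sub (hc : G.Connected) (r : V) (n : ℕ) {h : V → ℕ}
    (hdist : ∀ v, (∃ y ∈ {y | G.dist r y ≤ n}, G.dist v y = h v) ∧ ∀ y ∈ {y | G.dist r y ≤ n}, h v ≤ G.dist v y) (v : V) :
    h v = G.dist r v - n := by
  obtain ⟨⟨y₀, hy₀, hd₀⟩, hmin⟩ := hdist v
  rw [Set.mem_setOf_eq] at hy₀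
  rcases le_or_gt n (G.dist r v) with hn | hn
  · obtain ⟨y, hy, hd⟩ := exists_mem_ball_dist_eq_sub hc r n hn
    have h1 : h v ≤ G.dist r v - n := hd ▸ hmin y hy
    have h2 : G.dist r v - n ≤ h v := hd₀ ▸ sub_le_dist_of_mem_ball hc r n hy₀
    exact le_antisymm h1 h2
  · -- inside the ball: `h v = 0`
    have h1 : h v ≤ G.dist v v := hmin v (by rw [Set.mem_setOf_eq]; omega)
    rw [dist_self] at h1
    omega

/-- **THE LAYERS AROUND A BALL ARE SPHERES**: with `h` as above, `{v | h v = k} = {v | G.dist r v = n + k}` for `k ≥ 1` (and `{v | h v = 0} = B(r, n)`).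
[cite: Serre1980Trees, I.2.3] -/
theorem setOf_height_ball_eq_sphere (hc : G.Connected) (r : V) (n : ℕ) {h : V → ℕ}
    (hdist : ∀ v, (∃ y ∈ {y | G.dist r y ≤ n}, G.dist v y = h v) ∧ ∀ y ∈ {y | G.dist r y ≤ n}, h v ≤ G.dist v y) {k : ℕ} (hk : 1 ≤ k) :
    {v | h v = k} = {v | G.dist r v = n + k} := by
  ext v
  simp only [Set.mem_setOf_eq, height_ball_eq_dist_sub hc r n hdist v]
  omega

/-- The zeroth layer is the ball itself. [cite: Serre1980Trees, I.2.3] -/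
theorem setOf_height_ball_eq_zero (hc : G.Connected) (r : V) (n : ℕ) {h : V → ℕ}
    (hdist : ∀ v, (∃ y ∈ {y | G.dist r y ≤ n}, G.dist v y = h v) ∧ ∀ y ∈ {y | G.dist r y ≤ n}, h v ≤ G.dist v y) :
    {v | h v = 0} = {y | G.dist r y ≤ n} := by
  ext v
  simp only [Set.mem_setOf_eq, height_ball_eq_dist_sub hc r n hdist v]
  omega

/-! ## §3 The sphere counts `C_k` around a ball in a bi-regular tree -/

/-- **`C_k` FOR A BALL-SHAPED FIXED SET in a bi-regular tree**: for a locally finite tree with type function `c` (adjacent vertices of different types) and degrees `q (c v) + 1`,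
the `k`-th layer (`k ≥ 1`) around the ball `B(r, n)` has `(q a + 1)·(q b)^{⌊(n+k)∕2⌋}·(q a)^{⌊(n+k−1)∕2⌋}` vertices (`a = c r`, `b ≠ a`) — ★ `TreeLayers.ncard_sphere_eq_of_biregular`
at radius `n + k`.  With ★ `TreeDisplacement.setOf_dist_self_apply_eq` this is the number of vertices displaced by exactly `2k` by an elliptic automorphism whose fixed set is `B(r, n)`.
[cite: Serre1980Trees, II.1.1] -/
theorem ncard_layer_ball_eq_of_biregular [G.LocallyFinite] (hT : G.IsTree) (r : V) (n : ℕ) {h : V → ℕ}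
    (hdist : ∀ v, (∃ y ∈ {y | G.dist r y ≤ n}, G.dist v y = h v) ∧ ∀ y ∈ {y | G.dist r y ≤ n}, h v ≤ G.dist v y)
    (c : V → Fin 2) (hcol : ∀ v w, G.Adj v w → c v ≠ c w) (q : Fin 2 → ℕ) (hdeg : ∀ v, G.degree v = q (c v) + 1) {a b : Fin 2} (ha : c r = a) (hab : a ≠ b)
    {k : ℕ} (hk : 1 ≤ k) :
    {v | h v = k}.ncard = (q a + 1) * q b ^ ((n + k) / 2) * q a ^ ((n + k - 1) / 2) := by
  rw [setOf_height_ball_eq_sphere hT.1 r n hdist hk]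
  exact TreeLayers.ncard_sphere_eq_of_biregular hT r c hcol q hdeg ha hab (by omega)

end Literature.Combinatorics.SimpleGraph.BallLayers
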